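import Mathlib
import Summits.AnomalousDissipation.AnomalousDissipation.Theorems.LimitingAbsorptionFloorUpgradeStubCosTransformNonneg
import HarnessLib

/-!
# Sum rule for the cosine transform of a positive-definite function (stub A2)

Crux `LimitingAbsorption.FloorUpgrade` (stmt-AnomalousDissipation-15010), line `SketchIdeator1`,
stub `stub_cosTransform_sumRule`: for a continuous, even, exponentially bounded function
`C : ℝ → ℝ` that is positive-definite in the finite-sum sense, the cosine transform
`ρ(ξ) = ∫₀^∞ C(τ) cos(ξτ) dτ` is integrable on `ℝ` and `∫_ℝ ρ = π C(0)` (e.g. `C = e^{-|τ|}`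
gives `ρ(ξ) = 1/(1+ξ²)`, `∫ ρ = π`).

Route: normalise to `|C| ≤ 1` (`|C| ≤ C 0`, and `C 0 = 0` forces `C ≡ 0`); the tree's
`Literature.Analysis.FunctionSpaces.IsPositiveDefinite.integrable_fourier_gaussMul` bounds
`∫⁻ re 𝓕(e^{-σ|·|²/2} C) ≤ 1` uniformly in `σ > 0`; with `σ = 1/(n+1) → 0` and the pointwise
convergence `𝓕(e^{-σ|·|²/2} C) → 𝓕 C` (A1's `CosTransformNonneg.tendsto_fourier_gaussMul`),
Fatou's lemma gives `∫⁻ re 𝓕 C ≤ 1`; `𝓕 C` is real (limit of the real `𝓕(e^{-σ|·|²/2} C)`)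
with nonnegative real part, hence integrable; Mathlib's Fourier inversion
`Continuous.fourierInv_fourier_eq` at `0` gives `∫ 𝓕 C = C 0`; finally
`re 𝓕 C (w) = 2 ρ(2π w)` (A1's `CosTransformNonneg.re_fourier_ofReal_eq`) and the substitution
`ξ = 2π w`.
-/

set_option linter.dupNamespace false

noncomputable section

open MeasureTheory Set Filter Topology
open scoped BigOperators FourierTransform ComplexConjugate

namespace Summit.AnomalousDissipation.AnomalousDissipation.Theorems.FloorUpgradeLine

namespace CosTransformSumRule

open Literature.Analysis.FunctionSpaces CosTransformNonneg

/-- The Fourier transform of (the complexification of) a continuous, integrable, real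
positive-definite function bounded by `1` is real: `im 𝓕 C (w) = 0`, as the limit `σ → 0` of
`im 𝓕(e^{-σ|·|²/2} C)(w) = 0` (tree `IsPositiveDefinite.re_fourier_gauss_mul_nonneg`).
[folklore] -/
theorem im_fourier_eq_zero (D : ℝ → ℝ) (hDc : Continuous D) (hDi : Integrable D)
    (hPD : IsPositiveDefinite (fun τ : ℝ => (D τ : ℂ))) (hb : ∀ τ, |D τ| ≤ 1) (w : ℝ) :
    (𝓕 (fun τ : ℝ => (D τ : ℂ)) w).im = 0 := by
  have hDc' : Continuous fun τ : ℝ => (D τ : ℂ) := by fun_prop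
  have hDb : ∀ x, ‖((D x : ℝ) : ℂ)‖ ≤ 1 := fun x => by
    rw [Complex.norm_real, Real.norm_eq_abs]
    exact hb x
  have ht := (Complex.continuous_im.tendsto _).comp (tendsto_fourier_gaussMul _ hDc' hDi.ofReal w)
  refine tendsto_nhds_unique ht (tendsto_const_nhds.congr fun n => ?_)
  have hσ : (0 : ℝ) < 1 / ((n : ℝ) + 1) := by positivity
  exact ((hPD.re_fourier_gauss_mul_nonneg hDc' hDb hσ w).2).symm

/-- **Fatou step.** For a continuous, integrable, real positive-definite function bounded by
`1`, `∫⁻ (re 𝓕 C)₊ ≤ 1`: the tree's `IsPositiveDefinite.integrable_fourier_gaussMul` gives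
`∫⁻ re 𝓕(e^{-σ|·|²/2} C) ≤ 1` for every `σ > 0`, the regularised transforms converge pointwise
(`CosTransformNonneg.tendsto_fourier_gaussMul`, `σ = 1/(n+1)`), and Fatou's lemma
(Mathlib `lintegral_liminf_le`) passes to the limit. [folklore] -/
theorem lintegral_re_fourier_le_one (D : ℝ → ℝ) (hDc : Continuous D) (hDi : Integrable D)
    (hPD : IsPositiveDefinite (fun τ : ℝ => (D τ : ℂ))) (hb : ∀ τ, |D τ| ≤ 1) :
    ∫⁻ w, ENNReal.ofReal (𝓕 (fun τ : ℝ => (D τ : ℂ)) w).re ≤ 1 := by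
  have hDc' : Continuous fun τ : ℝ => (D τ : ℂ) := by fun_prop
  have hDi' : Integrable fun τ : ℝ => (D τ : ℂ) := hDi.ofReal
  have hDb : ∀ x, ‖((D x : ℝ) : ℂ)‖ ≤ 1 := fun x => by
    rw [Complex.norm_real, Real.norm_eq_abs]
    exact hb x
  -- the Gaussian regularisations `𝓕 (e^{-|v|² / (2(n+1))} D)`
  set q : ℕ → ℝ → ℂ := fun n =>
    𝓕 (fun v : ℝ => (Real.exp (-((1 / ((n : ℝ) + 1)) / 2) * ‖v‖ ^ 2) : ℂ) * (D v : ℂ))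
  have hσ : ∀ n : ℕ, (0 : ℝ) < 1 / ((n : ℝ) + 1) := fun n => by positivity
  have hq_le : ∀ n, ∫⁻ w, ENNReal.ofReal (q n w).re ≤ 1 := fun n =>
    (hPD.integrable_fourier_gaussMul hDc' hDb (hσ n)).2
  have hq_meas : ∀ n, Measurable fun w => ENNReal.ofReal (q n w).re := fun n => by
    have hqc : Continuous (q n) :=
      VectorFourier.fourierIntegral_continuous Real.continuous_fourierChar
        (by exact continuous_inner) (integrable_gaussMul hDc' hDb (hσ n))
    exact ENNReal.measurable_ofReal.comp (Complex.continuous_re.comp hqc).measurable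
  have hq_lim : ∀ w, liminf (fun n => ENNReal.ofReal (q n w).re) atTop =
      ENNReal.ofReal (𝓕 (fun τ : ℝ => (D τ : ℂ)) w).re := fun w =>
    ((ENNReal.continuous_ofReal.tendsto _).comp ((Complex.continuous_re.tendsto _).comp
      (tendsto_fourier_gaussMul _ hDc' hDi' w))).liminf_eq
  calc ∫⁻ w, ENNReal.ofReal (𝓕 (fun τ : ℝ => (D τ : ℂ)) w).re
      = ∫⁻ w, liminf (fun n => ENNReal.ofReal (q n w).re) atTop :=
        lintegral_congr fun w => (hq_lim w).symm
    _ ≤ liminf (fun n => ∫⁻ w, ENNReal.ofReal (q n w).re) atTop := lintegral_liminf_le hq_meas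
    _ ≤ 1 := liminf_le_of_frequently_le' (Frequently.of_forall hq_le)

/-- **Integrability of the Fourier transform.** For a continuous, integrable, real
positive-definite function bounded by `1` whose Fourier transform has nonnegative real part,
`𝓕 C ∈ L¹(ℝ)`: `𝓕 C` is continuous, real (`im_fourier_eq_zero`), and `∫⁻ re 𝓕 C ≤ 1`
(`lintegral_re_fourier_le_one`). [folklore] -/
theorem integrable_fourier_ofReal (D : ℝ → ℝ) (hDc : Continuous D) (hDi : Integrable D)
    (hPD : IsPositiveDefinite (fun τ : ℝ => (D τ : ℂ))) (hb : ∀ τ, |D τ| ≤ 1)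
    (hre : ∀ w, 0 ≤ (𝓕 (fun τ : ℝ => (D τ : ℂ)) w).re) :
    Integrable (𝓕 (fun τ : ℝ => (D τ : ℂ))) := by
  have hDi' : Integrable fun τ : ℝ => (D τ : ℂ) := hDi.ofReal
  have hcont : Continuous (𝓕 (fun τ : ℝ => (D τ : ℂ))) :=
    VectorFourier.fourierIntegral_continuous Real.continuous_fourierChar
      (by exact continuous_inner) hDi'
  have hre_int : Integrable (fun w => (𝓕 (fun τ : ℝ => (D τ : ℂ)) w).re) := by
    refine ⟨(Complex.continuous_re.comp hcont).aestronglyMeasurable, ?_⟩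
    rw [hasFiniteIntegral_iff_enorm]
    calc ∫⁻ w, ‖(𝓕 (fun τ : ℝ => (D τ : ℂ)) w).re‖ₑ
        = ∫⁻ w, ENNReal.ofReal (𝓕 (fun τ : ℝ => (D τ : ℂ)) w).re :=
          lintegral_congr fun w => Real.enorm_eq_ofReal (hre w)
      _ ≤ 1 := lintegral_re_fourier_le_one D hDc hDi hPD hb
      _ < ⊤ := ENNReal.one_lt_top
  have heq : ∀ w, 𝓕 (fun τ : ℝ => (D τ : ℂ)) w =
      (((𝓕 (fun τ : ℝ => (D τ : ℂ)) w).re : ℝ) : ℂ) := fun w =>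
    Complex.ext (by simp) (by simp [im_fourier_eq_zero D hDc hDi hPD hb w])
  exact (hre_int.ofReal (𝕜 := ℂ)).congr (ae_of_all _ fun w => (heq w).symm)

/-- **The normalised sum rule.** For a continuous, integrable, even, real positive-definite `C`
with `|C| ≤ 1` and nonnegative cosine transform `ρ(ξ) = ∫₀^∞ C(τ) cos(ξτ) dτ`: `ρ ∈ L¹(ℝ)` and
`∫ ρ = π C(0)`. Indeed `re 𝓕 C (w) = 2ρ(2πw)` (A1), `𝓕 C ∈ L¹` (`integrable_fourier_ofReal`),
so `ρ ∈ L¹` by rescaling; and Fourier inversion (Mathlib `Continuous.fourierInv_fourier_eq`) at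
`0` reads `C 0 = ∫ 𝓕 C = ∫ 2ρ(2πw) dw = π⁻¹ ∫ ρ`. [folklore] -/
theorem sumRule_of_abs_le_one (C : ℝ → ℝ) (hC : Continuous C) (hint : Integrable C)
    (heven : ∀ τ, C (-τ) = C τ) (hPD : IsPositiveDefinite (fun τ : ℝ => (C τ : ℂ)))
    (hb : ∀ τ, |C τ| ≤ 1)
    (hnonneg : ∀ ξ : ℝ, 0 ≤ ∫ τ in Ioi (0 : ℝ), C τ * Real.cos (ξ * τ)) :
    Integrable (fun ξ : ℝ => ∫ τ in Ioi (0 : ℝ), C τ * Real.cos (ξ * τ)) ∧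
      ∫ ξ, (∫ τ in Ioi (0 : ℝ), C τ * Real.cos (ξ * τ)) = Real.pi * C 0 := by
  have hfc : Continuous fun τ : ℝ => (C τ : ℂ) := by fun_prop
  have hfi : Integrable fun τ : ℝ => (C τ : ℂ) := hint.ofReal
  -- `ρ(ξ) = (1/2) re 𝓕 C (ξ / 2π)`
  have hρ : ∀ ξ : ℝ, ∫ τ in Ioi (0 : ℝ), C τ * Real.cos (ξ * τ) =
      1 / 2 * (𝓕 (fun τ : ℝ => (C τ : ℂ)) (ξ / (2 * Real.pi))).re := by
    intro ξ
    rw [re_fourier_ofReal_eq C hC hint heven]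
    have h2 : 2 * Real.pi * (ξ / (2 * Real.pi)) = ξ := by
      field_simp
    rw [h2]
    ring
  have hre : ∀ w, 0 ≤ (𝓕 (fun τ : ℝ => (C τ : ℂ)) w).re := fun w => by
    rw [re_fourier_ofReal_eq C hC hint heven]
    exact mul_nonneg zero_le_two (hnonneg _)
  have hFi : Integrable (𝓕 (fun τ : ℝ => (C τ : ℂ))) :=
    integrable_fourier_ofReal C hC hint hPD hb hre
  have hre_int : Integrable (fun w => (𝓕 (fun τ : ℝ => (C τ : ℂ)) w).re) := hFi.re
  refine ⟨?_, ?_⟩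
  · have h1 : Integrable (fun ξ : ℝ => (𝓕 (fun τ : ℝ => (C τ : ℂ)) (ξ / (2 * Real.pi))).re) :=
      hre_int.comp_div (by positivity)
    exact (h1.const_mul (1 / 2)).congr (ae_of_all _ fun ξ => (hρ ξ).symm)
  · -- Fourier inversion at `0`: `C 0 = ∫ 𝓕 C`
    have hinv : 𝓕⁻ (𝓕 (fun τ : ℝ => (C τ : ℂ))) = fun τ : ℝ => (C τ : ℂ) :=
      hfc.fourierInv_fourier_eq hfi hFi
    have h0 : (C 0 : ℂ) = ∫ w, 𝓕 (fun τ : ℝ => (C τ : ℂ)) w := by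
      have h := congrFun hinv 0
      rw [Real.fourierInv_eq'] at h
      simpa using h.symm
    have h0re : C 0 = ∫ w, (𝓕 (fun τ : ℝ => (C τ : ℂ)) w).re := by
      have h := congrArg Complex.re h0
      rw [Complex.ofReal_re] at h
      rw [h, ← RCLike.re_to_complex, ← integral_re hFi]
      simp only [RCLike.re_to_complex]
    have hscale : ∫ ξ : ℝ, (𝓕 (fun τ : ℝ => (C τ : ℂ)) (ξ / (2 * Real.pi))).re =
        |2 * Real.pi| • ∫ w, (𝓕 (fun τ : ℝ => (C τ : ℂ)) w).re :=
      Measure.integral_comp_div (fun w => (𝓕 (fun τ : ℝ => (C τ : ℂ)) w).re) (2 * Real.pi)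
    calc ∫ ξ, (∫ τ in Ioi (0 : ℝ), C τ * Real.cos (ξ * τ))
        = ∫ ξ, 1 / 2 * (𝓕 (fun τ : ℝ => (C τ : ℂ)) (ξ / (2 * Real.pi))).re :=
          integral_congr_ae (ae_of_all _ fun ξ => hρ ξ)
      _ = 1 / 2 * (|2 * Real.pi| • ∫ w, (𝓕 (fun τ : ℝ => (C τ : ℂ)) w).re) := by
          rw [integral_const_mul, hscale]
      _ = Real.pi * C 0 := by
          rw [← h0re, abs_of_pos (by positivity), smul_eq_mul]
          ring

end CosTransformSumRule

open CosTransformNonneg CosTransformSumRule in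
/-- **A2.** Sum rule for the cosine transform `ρ(ξ) = ∫₀^∞ C(τ) cos(ξτ) dτ` of a continuous,
even, exponentially bounded function that is positive-definite in the finite-sum sense:
`ρ ∈ L¹(ℝ)` and `∫_ℝ ρ = π C(0)`. Proof: `|C| ≤ C 0` and `C 0 = 0 ⇒ C ≡ 0`; otherwise apply the
normalised sum rule `CosTransformSumRule.sumRule_of_abs_le_one` (Gaussian regularisation,
Fatou, Fourier inversion at `0`) to `C / C 0`. [folklore] -/
theorem stub_cosTransform_sumRule (C : ℝ → ℝ) (A γ : ℝ) (hC : Continuous C) (hγ : 0 < γ)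
    (heven : ∀ τ, C (-τ) = C τ)
    (hA : ∀ τ, |C τ| ≤ A * Real.exp (-(γ * |τ|)))
    (hpd : ∀ (n : ℕ) (τ c : Fin n → ℝ), 0 ≤ ∑ i, ∑ j, c i * c j * C (τ i - τ j))
    (hnonneg : ∀ ξ : ℝ, 0 ≤ ∫ τ in Ioi (0 : ℝ), C τ * Real.cos (ξ * τ)) :
    Integrable (fun ξ : ℝ => ∫ τ in Ioi (0 : ℝ), C τ * Real.cos (ξ * τ)) ∧
      ∫ ξ, (∫ τ in Ioi (0 : ℝ), C τ * Real.cos (ξ * τ)) = Real.pi * C 0 := by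
  have hint : Integrable C := integrable_of_abs_le_exp C A γ hC hγ hA
  have hb0 : ∀ τ, |C τ| ≤ C 0 := abs_le_apply_zero C heven hpd
  rcases eq_or_lt_of_le ((abs_nonneg _).trans (hb0 0)) with h0 | h0
  · have hCz : ∀ τ, C τ = 0 := fun τ => abs_nonpos_iff.1 (h0 ▸ hb0 τ)
    simp [hCz]
  · set C' : ℝ → ℝ := fun τ => C τ / C 0 with hC'
    have hC'c : Continuous C' := hC.div_const _
    have hC'i : Integrable C' := hint.div_const _
    have hC'e : ∀ τ, C' (-τ) = C' τ := fun τ => by simp only [hC', heven]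
    have hC'pd : ∀ (n : ℕ) (τ c : Fin n → ℝ), 0 ≤ ∑ i, ∑ j, c i * c j * C' (τ i - τ j) := by
      intro n τ c
      have h : ∑ i, ∑ j, c i * c j * C' (τ i - τ j) =
          (∑ i, ∑ j, c i * c j * C (τ i - τ j)) / C 0 := by
        rw [Finset.sum_div]
        refine Finset.sum_congr rfl fun i _ => ?_
        rw [Finset.sum_div]
        refine Finset.sum_congr rfl fun j _ => ?_
        rw [hC', mul_div_assoc]
      rw [h]
      exact div_nonneg (hpd n τ c) h0.le
    have hC'b : ∀ τ, |C' τ| ≤ 1 := fun τ => by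
      rw [hC', abs_div, abs_of_pos h0, div_le_one h0]
      exact hb0 τ
    have h3 : ∀ ξ : ℝ, ∫ τ in Ioi (0 : ℝ), C' τ * Real.cos (ξ * τ) =
        (∫ τ in Ioi (0 : ℝ), C τ * Real.cos (ξ * τ)) / C 0 := fun ξ => by
      rw [← integral_div]
      refine integral_congr_ae (ae_of_all _ fun τ => ?_)
      simp only [hC']
      ring
    have hC'n : ∀ ξ : ℝ, 0 ≤ ∫ τ in Ioi (0 : ℝ), C' τ * Real.cos (ξ * τ) := fun ξ => by
      rw [h3]
      exact div_nonneg (hnonneg ξ) h0.le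
    obtain ⟨hI, hV⟩ := sumRule_of_abs_le_one C' hC'c hC'i hC'e
      (isPositiveDefinite_ofReal C' hC'e hC'pd) hC'b hC'n
    have h4 : ∀ ξ : ℝ, ∫ τ in Ioi (0 : ℝ), C τ * Real.cos (ξ * τ) =
        C 0 * ∫ τ in Ioi (0 : ℝ), C' τ * Real.cos (ξ * τ) := fun ξ => by
      rw [h3, mul_div_cancel₀ _ h0.ne']
    refine ⟨(hI.const_mul (C 0)).congr (ae_of_all _ fun ξ => (h4 ξ).symm), ?_⟩
    have hC'0 : C' 0 = 1 := by
      simp only [hC']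
      exact div_self h0.ne'
    calc ∫ ξ, (∫ τ in Ioi (0 : ℝ), C τ * Real.cos (ξ * τ))
        = ∫ ξ, C 0 * ∫ τ in Ioi (0 : ℝ), C' τ * Real.cos (ξ * τ) :=
          integral_congr_ae (ae_of_all _ fun ξ => h4 ξ)
      _ = Real.pi * C 0 := by
          rw [integral_const_mul, hV, hC'0]
          ring

end Summit.AnomalousDissipation.AnomalousDissipation.Theorems.FloorUpgradeLine

end
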